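import Mathlib
import Literature.Analysis.FluidPDE.SteadyNSLocalEnergy
import Literature.Analysis.FluidPDE.SteadyLiouvilleTsaiPressure
import Summits.AnomalousDissipation.AnomalousDissipation.Theorems.DyadicWallCascadeDyadicRealisationFluxSignTools2
import Summits.AnomalousDissipation.AnomalousDissipation.Theorems.DyadicWallCascadeDyadicRealisationFluxSignTools4
import HarnessLib

/-!
# The tested horizontal momentum identity for the zero-stress stub

Tools file for `stub_zeroStress` of
`Summit.AnomalousDissipation.AnomalousDissipation.Theses.DyadicWallCascade.DyadicRealisation`
(line Sketch):

* `zeroStress_momentum_identity` — for a classical steady Navier–Stokes pair `(u, p)` on `ℝ³`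
  (`IsLerayProfile 1 0 u p`), a test function `φ ∈ C²_c` and a fixed vector `a`,
  `∫ ⟪u, a⟫ (Dφ·u) + ∫ p (Dφ·a) + ∫ (Δφ) ⟪u, a⟫ = 0` (the momentum equation tested against
  `φ a`, integrated by parts on the whole space);
* `zeroStress_momentum_scaled` — for a bounded smooth solution `(W, P)` of the clause-form
  steady system and `φ ∈ C²_c`, the blow-downs satisfy
  `|∫ W_i(λ·) (Dφ·W(λ·)) + ∫ P(λ·) ∂ᵢφ| ≤ λ⁻¹ A` with `A` independent of `λ`
  (the identity for the Navier–Stokes rescaling `(λW(λ·), λ²P(λ·))`, divided by `λ²`);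
* `zeroStress_density_lipschitz` — the Reynolds-stress density `w₂ wᵢ` is Lipschitz on bounded
  sets;
* `zeroStress_limit_abs` — two-sided version of the blow-down limit lemma `fluxSign_limit_le`.

The file ends with the registered tools stub `stub_zeroStressTools`.
-/

open MeasureTheory Set Filter Topology Function
open Literature.Analysis.FluidPDE
open scoped BigOperators Laplacian RealInnerProductSpace

set_option linter.dupNamespace false

namespace Summit.AnomalousDissipation.AnomalousDissipation.Theorems

/-- **Tested momentum identity.**  For `IsLerayProfile 1 0 u p` on `ℝ³`
(`−Δu + (u·∇)u + ∇p = 0`, `div u = 0`, `u ∈ C²`, `p ∈ C¹`), a test function `φ ∈ C²_c` and a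
fixed vector `a`, `∫ ⟪u, a⟫ (Dφ·u) + ∫ p (Dφ·a) + ∫ (Δφ) ⟪u, a⟫ = 0`: test the equation with
`φ a`; Green's identity twice (`∫⟪Δu, φa⟫ = ∫ (Δφ)⟪u, a⟫`), the trilinear identity
(`∫ φ⟪(u·∇)u, a⟫ = −∫ (Dφ·u)⟪u, a⟫`) and `∫⟪∇p, φa⟫ = −∫ p (Dφ·a)`. [folklore] -/
theorem zeroStress_momentum_identity
    {u : EuclideanSpace ℝ (Fin 3) → EuclideanSpace ℝ (Fin 3)} {p : EuclideanSpace ℝ (Fin 3) → ℝ}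
    (h : IsLerayProfile 1 0 u p) {φ : EuclideanSpace ℝ (Fin 3) → ℝ} (hφ : ContDiff ℝ 2 φ)
    (hφc : HasCompactSupport φ) (a : EuclideanSpace ℝ (Fin 3)) :
    (∫ x, ⟪u x, a⟫ * fderiv ℝ φ x (u x)) + (∫ x, p x * fderiv ℝ φ x a) +
      ∫ x, (Δ φ) x * ⟪u x, a⟫ = 0 := by
  set b := stdOrthonormalBasis ℝ (EuclideanSpace ℝ (Fin 3)) with hb
  -- regularity
  have hu2 : ContDiff ℝ 2 u := h.contDiff_velocity
  have hu1 : ContDiff ℝ 1 u := hu2.of_le one_le_two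
  have hp1 : ContDiff ℝ 1 p := h.contDiff_pressure
  have hφ1 : ContDiff ℝ 1 φ := hφ.of_le one_le_two
  have hud : ∀ x, DifferentiableAt ℝ u x := fun x => hu1.differentiable one_ne_zero x
  have hφd : ∀ x, DifferentiableAt ℝ φ x := fun x => hφ1.differentiable one_ne_zero x
  have huc : Continuous u := hu1.continuous
  have hDuc : Continuous (fderiv ℝ u) := hu1.continuous_fderiv one_ne_zero
  have hφcn : Continuous φ := hφ1.continuous
  have hDφc : Continuous (fderiv ℝ φ) := hφ1.continuous_fderiv one_ne_zero
  have hpc : Continuous p := hp1.continuous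
  set w : EuclideanSpace ℝ (Fin 3) → EuclideanSpace ℝ (Fin 3) := fun x => φ x • a with hw
  have hw1 : ContDiff ℝ 1 w := hφ1.smul contDiff_const
  have hwc : HasCompactSupport w := hφc.smul_right (f' := fun _ => a)
  have hDφcs : HasCompactSupport (fderiv ℝ φ) := hφc.fderiv (𝕜 := ℝ)
  -- the derivative of `w = φ a`
  have hDw : ∀ x v, fderiv ℝ w x v = fderiv ℝ φ x v • a := fun x v => by
    rw [hw, fderiv_smul_const (hφd x) a, ContinuousLinearMap.smulRight_apply]
  -- (1) the equation tested against `w`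
  have heq : ∀ x, ⟪(Δ u) x, w x⟫ = φ x * ⟪convect u u x, a⟫ + φ x * ⟪gradient p x, a⟫ := by
    intro x
    rw [h.laplacian_eq_of_steady x, hw]
    simp only [inner_add_left, real_inner_smul_right]
  -- (2) Green's identity for `v = u`, `w = φ a`
  have green1 := integral_inner_laplacian_add_eq_zero b hu2 hw1 (Or.inr hwc)
  have hpair : ∀ x i, ⟪fderiv ℝ u x (b i), fderiv ℝ w x (b i)⟫ =
      fderiv ℝ φ x (b i) * ⟪fderiv ℝ u x (b i), a⟫ := fun x i => by
    rw [hDw, real_inner_smul_right]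
  -- (3) Green's identity for `v = φ`, `w = ⟪u, a⟫`
  set g : EuclideanSpace ℝ (Fin 3) → ℝ := fun x => ⟪u x, a⟫ with hg
  have hg1 : ContDiff ℝ 1 g := hu1.inner ℝ contDiff_const
  have hDg : ∀ x v, fderiv ℝ g x v = ⟪fderiv ℝ u x v, a⟫ := fun x v => by
    rw [hg, fderiv_inner_apply ℝ (hud x) (differentiableAt_const a)]
    simp
  have green2 := integral_inner_laplacian_add_eq_zero b (F' := ℝ) hφ hg1 (Or.inl hφc)
  have hg2a : ∫ x, ⟪(Δ φ) x, g x⟫ = ∫ x, (Δ φ) x * ⟪u x, a⟫ :=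
    integral_congr_ae (Eventually.of_forall fun x => by
      simp only [hg, RCLike.inner_apply, conj_trivial, mul_comm])
  have hg2b : ∀ i, ∫ x, ⟪fderiv ℝ φ x (b i), fderiv ℝ g x (b i)⟫ =
      ∫ x, fderiv ℝ φ x (b i) * ⟪fderiv ℝ u x (b i), a⟫ := fun i =>
    integral_congr_ae (Eventually.of_forall fun x => by
      simp only [RCLike.inner_apply, conj_trivial, hDg, mul_comm])
  -- (4) the trilinear identity
  have conv := integral_inner_convect_add_eq_zero (F' := EuclideanSpace ℝ (Fin 3)) hu1 hu1 hw1 hwc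
  have hconv3 : ∫ x, VectorCalculus.divergence u x * ⟪u x, w x⟫ = 0 := by
    rw [← integral_zero (α := EuclideanSpace ℝ (Fin 3)) (G := ℝ)]
    refine integral_congr_ae (Eventually.of_forall fun x => ?_)
    show VectorCalculus.divergence u x * ⟪u x, w x⟫ = 0
    rw [h.divFree x, zero_mul]
  have hconv2 : ∀ x, ⟪u x, convect u w x⟫ = fderiv ℝ φ x (u x) * ⟪u x, a⟫ := fun x => by
    rw [convect_apply, hDw, real_inner_smul_right]
  have hconv1 : ∀ x, ⟪convect u u x, w x⟫ = φ x * ⟪convect u u x, a⟫ := fun x => by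
    rw [hw, real_inner_smul_right]
  -- (5) the pressure identity
  have press := integral_inner_gradient_eq_neg_integral_mul_divergence hp1 hw1 hwc
  have hdivw : ∀ x, VectorCalculus.divergence w x = fderiv ℝ φ x a := fun x => by
    have h1 := divergence_smul_apply (u := fun _ => a) (θ := φ) (hφd x) (differentiableAt_const a)
    have h2 : VectorCalculus.divergence (fun _ : EuclideanSpace ℝ (Fin 3) => a) x = 0 := by
      simp [VectorCalculus.divergence]
    rw [hw, h1, h2, mul_zero, zero_add, gradient, real_inner_comm,
      InnerProductSpace.toDual_symm_apply]
  have hpress1 : ∀ x, ⟪gradient p x, w x⟫ = φ x * ⟪gradient p x, a⟫ := fun x => by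
    rw [hw, real_inner_smul_right]
  -- integrability (continuous, compactly supported integrands)
  have hcs_φ : ∀ f : EuclideanSpace ℝ (Fin 3) → ℝ, HasCompactSupport fun x => φ x * f x :=
    fun f => hφc.mul_right
  have hI_A : Integrable (fun x => φ x * ⟪convect u u x, a⟫) :=
    (hφcn.mul ((hDuc.clm_apply huc).inner continuous_const)).integrable_of_hasCompactSupport
      (hcs_φ _)
  have hI_P : Integrable (fun x => φ x * ⟪gradient p x, a⟫) :=
    (hφcn.mul ((continuous_gradient_of_contDiff hp1).inner continuous_const))
      |>.integrable_of_hasCompactSupport (hcs_φ _)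
  have hcs_D : ∀ (v : EuclideanSpace ℝ (Fin 3) → EuclideanSpace ℝ (Fin 3))
      (f : EuclideanSpace ℝ (Fin 3) → ℝ),
      HasCompactSupport fun x => fderiv ℝ φ x (v x) * f x := fun v f =>
    hDφcs.mono fun x hx => by
      rw [mem_support] at hx ⊢
      contrapose! hx
      simp [hx]
  have hI_S : ∀ i, Integrable (fun x => fderiv ℝ φ x (b i) * ⟪fderiv ℝ u x (b i), a⟫) :=
    fun i => (((hDφc.clm_apply continuous_const).mul
      ((hDuc.clm_apply continuous_const).inner continuous_const))).integrable_of_hasCompactSupport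
        (hcs_D (fun _ => b i) _)
  -- assemble
  have e1 : ∫ x, ⟪(Δ u) x, w x⟫ = (∫ x, φ x * ⟪convect u u x, a⟫) +
      ∫ x, φ x * ⟪gradient p x, a⟫ := by
    rw [← integral_add hI_A hI_P]
    exact integral_congr_ae (Eventually.of_forall heq)
  have e2 : ∑ i, ∫ x, ⟪fderiv ℝ u x (b i), fderiv ℝ w x (b i)⟫ =
      ∑ i, ∫ x, fderiv ℝ φ x (b i) * ⟪fderiv ℝ u x (b i), a⟫ :=
    Finset.sum_congr rfl fun i _ => integral_congr_ae (Eventually.of_forall fun x => hpair x i)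
  have e3 : ∑ i, ∫ x, ⟪fderiv ℝ φ x (b i), fderiv ℝ g x (b i)⟫ =
      ∑ i, ∫ x, fderiv ℝ φ x (b i) * ⟪fderiv ℝ u x (b i), a⟫ :=
    Finset.sum_congr rfl fun i _ => hg2b i
  have e4 : ∫ x, ⟪u x, convect u w x⟫ = ∫ x, fderiv ℝ φ x (u x) * ⟪u x, a⟫ :=
    integral_congr_ae (Eventually.of_forall hconv2)
  have e5 : ∫ x, ⟪convect u u x, w x⟫ = ∫ x, φ x * ⟪convect u u x, a⟫ :=
    integral_congr_ae (Eventually.of_forall hconv1)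
  have e6 : ∫ x, ⟪gradient p x, w x⟫ = ∫ x, φ x * ⟪gradient p x, a⟫ :=
    integral_congr_ae (Eventually.of_forall hpress1)
  have e7 : ∫ x, p x * VectorCalculus.divergence w x = ∫ x, p x * fderiv ℝ φ x a :=
    integral_congr_ae (Eventually.of_forall fun x => by
      show p x * VectorCalculus.divergence w x = p x * fderiv ℝ φ x a
      rw [hdivw x])
  have e8 : ∫ x, ⟪u x, a⟫ * fderiv ℝ φ x (u x) = ∫ x, fderiv ℝ φ x (u x) * ⟪u x, a⟫ :=
    integral_congr_ae (Eventually.of_forall fun x => mul_comm _ _)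
  rw [e1, e2] at green1
  rw [hg2a, e3] at green2
  rw [e5, e4, hconv3] at conv
  rw [e6, e7] at press
  rw [e8]
  have _ := hI_S
  linarith

/-- **Scaled tested momentum identity.**  For a bounded smooth solution `(W, P)` of the
clause-form steady Navier–Stokes system on `ℝ³` (unit viscosity, no force), a test function
`φ ∈ C²_c` and a coordinate direction `eᵢ`, there is `A` such that for every `λ > 0`
`|∫ W_i(λY) (Dφ(Y)·W(λY)) dY + ∫ P(λY) ∂ᵢφ(Y) dY| ≤ λ⁻¹ A`: the tested momentum identity for
the rescaled solution `(λW(λ·), λ²P(λ·))`, divided by `λ²`, with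
`|∫ (Δφ) W_i(λ·)| ≤ A := sup|W| ∫|Δφ|`. [folklore] -/
theorem zeroStress_momentum_scaled
    (W : EuclideanSpace ℝ (Fin 3) → EuclideanSpace ℝ (Fin 3)) (P : EuclideanSpace ℝ (Fin 3) → ℝ)
    (φ : EuclideanSpace ℝ (Fin 3) → ℝ) (C' : ℝ) (i : Fin 3)
    (hW : ContDiff ℝ ((⊤ : ℕ∞) : WithTop ℕ∞) W) (hP : ContDiff ℝ ((⊤ : ℕ∞) : WithTop ℕ∞) P)
    (hdiv : ∀ X, ∑ i : Fin 3, (fderiv ℝ W X (EuclideanSpace.single i (1 : ℝ))) i = 0)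
    (hNS : ∀ X, (fderiv ℝ W X) (W X) + gradient P X =
      ∑ i : Fin 3, fderiv ℝ (fun Y => fderiv ℝ W Y (EuclideanSpace.single i (1 : ℝ))) X
        (EuclideanSpace.single i (1 : ℝ)))
    (hWb : ∀ X, ‖W X‖ ≤ C') (hφ : ContDiff ℝ 2 φ) (hφc : HasCompactSupport φ) :
    ∃ A : ℝ, ∀ lam : ℝ, 0 < lam →
      |(∫ Y, (W (lam • Y)) i * fderiv ℝ φ Y (W (lam • Y))) +
          ∫ Y, P (lam • Y) * fderiv ℝ φ Y (EuclideanSpace.single i (1 : ℝ))| ≤ lam⁻¹ * A := by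
  have hprof : IsLerayProfile 1 0 W P := fluxSign_isLerayProfile hW hP hdiv hNS
  have hWc : Continuous W := hW.continuous
  have hΔφc : Continuous (Δ φ) := continuous_laplacian hφ
  have hΔφcs : HasCompactSupport (Δ φ) := hφc.mono' fun x hx => by
    contrapose! hx; simp [laplacian_eq_zero_of_notMem_tsupport hx]
  set K : ℝ := ∫ Y, |(Δ φ) Y| with hK
  refine ⟨C' * K, fun lam hlam => ?_⟩
  set a : EuclideanSpace ℝ (Fin 3) := EuclideanSpace.single i (1 : ℝ) with ha
  have hsc : Continuous fun Y : EuclideanSpace ℝ (Fin 3) => lam • Y := continuous_const_smul lam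
  have hWl : Continuous fun Y : EuclideanSpace ℝ (Fin 3) => W (lam • Y) := hWc.comp hsc
  have hinner : ∀ v : EuclideanSpace ℝ (Fin 3), ⟪v, a⟫ = v i := fun v => by
    rw [ha, EuclideanSpace.inner_single_right]; simp
  -- the identity for the rescaled solution
  have hl := Tsai2021.isLerayProfile_scale hprof hlam
  have hid := zeroStress_momentum_identity hl hφ hφc a
  have e1 : ∫ x, ⟪lam • W (lam • x), a⟫ * fderiv ℝ φ x (lam • W (lam • x)) =
      lam ^ 2 * ∫ x, (W (lam • x)) i * fderiv ℝ φ x (W (lam • x)) := by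
    rw [← integral_const_mul]
    refine integral_congr_ae (Eventually.of_forall fun x => ?_)
    simp only
    rw [hinner, map_smul, PiLp.smul_apply, smul_eq_mul, smul_eq_mul]; ring
  have e2 : ∫ x, lam ^ 2 * P (lam • x) * fderiv ℝ φ x a =
      lam ^ 2 * ∫ x, P (lam • x) * fderiv ℝ φ x a := by
    rw [← integral_const_mul]
    refine integral_congr_ae (Eventually.of_forall fun x => ?_)
    simp only
    ring
  have e3 : ∫ x, (Δ φ) x * ⟪lam • W (lam • x), a⟫ = lam * ∫ x, (Δ φ) x * (W (lam • x)) i := by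
    rw [← integral_const_mul]
    refine integral_congr_ae (Eventually.of_forall fun x => ?_)
    simp only
    rw [hinner, PiLp.smul_apply, smul_eq_mul]; ring
  rw [e1, e2, e3] at hid
  -- the Laplacian term
  have hI1 : Integrable fun x => (Δ φ) x * (W (lam • x)) i :=
    (hΔφc.mul ((PiLp.continuous_apply 2 _ i).comp hWl)).integrable_of_hasCompactSupport
      hΔφcs.mul_right
  have hI1' : Integrable fun x => |(Δ φ) x| * C' :=
    ((continuous_abs.comp hΔφc).mul continuous_const).integrable_of_hasCompactSupport
      (hΔφcs.abs.mul_right)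
  have hA : |∫ x, (Δ φ) x * (W (lam • x)) i| ≤ C' * K := by
    rw [hK, ← integral_const_mul]
    simp_rw [mul_comm C']
    refine (Real.norm_eq_abs _).symm.le.trans (norm_integral_le_of_norm_le hI1'
      (Eventually.of_forall fun x => ?_))
    rw [Real.norm_eq_abs, abs_mul]
    refine mul_le_mul_of_nonneg_left ?_ (abs_nonneg _)
    exact ((Real.norm_eq_abs _).symm.le.trans (PiLp.norm_apply_le (W (lam • x)) i)).trans (hWb _)
  have _ := hI1
  -- divide by `λ²`
  have h2 : 0 < lam ^ 2 := pow_pos hlam 2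
  have hlam0 : lam ≠ 0 := hlam.ne'
  set T1 : ℝ := ∫ x, (W (lam • x)) i * fderiv ℝ φ x (W (lam • x)) with hT1
  set T2 : ℝ := ∫ x, P (lam • x) * fderiv ℝ φ x a with hT2
  set L : ℝ := ∫ x, (Δ φ) x * (W (lam • x)) i with hL
  have key : T1 + T2 = -(lam⁻¹ * L) := by
    have h1 : lam * (lam * (T1 + T2) + L) = 0 := by linear_combination hid
    have h3 : lam * (T1 + T2) + L = 0 := by
      rcases mul_eq_zero.1 h1 with h | h
      · exact absurd h hlam0
      · exact h
    calc T1 + T2 = lam⁻¹ * (lam * (T1 + T2)) := by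
          rw [← mul_assoc, inv_mul_cancel₀ hlam0, one_mul]
      _ = -(lam⁻¹ * L) := by rw [show lam * (T1 + T2) = -L by linarith]; ring
  rw [key, abs_neg, abs_mul, abs_of_pos (inv_pos.2 hlam)]
  exact mul_le_mul_of_nonneg_left hA (inv_pos.2 hlam).le

/-- **The Reynolds-stress density is Lipschitz on bounded sets**: for `|w| ≤ C'` and `|v| ≤ C`,
`|w₂ wᵢ − v₂ vᵢ| ≤ (|C'| + |C|) |w − v|`. [folklore] -/
theorem zeroStress_density_lipschitz (w v : EuclideanSpace ℝ (Fin 3)) (C C' : ℝ) (i : Fin 3)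
    (hw : ‖w‖ ≤ C') (hv : ‖v‖ ≤ C) :
    |w 2 * w i - v 2 * v i| ≤ (|C'| + |C|) * ‖w - v‖ := by
  have h2 : |w 2 - v 2| ≤ ‖w - v‖ := by
    have := PiLp.norm_apply_le (w - v) 2
    simpa using this
  have hi : |w i - v i| ≤ ‖w - v‖ := by
    have := PiLp.norm_apply_le (w - v) i
    simpa using this
  have hwi : |w i| ≤ |C'| := by
    have := PiLp.norm_apply_le w i
    rw [Real.norm_eq_abs] at this
    exact this.trans (hw.trans (le_abs_self C'))
  have hv2 : |v 2| ≤ |C| := by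
    have := PiLp.norm_apply_le v 2
    rw [Real.norm_eq_abs] at this
    exact this.trans (hv.trans (le_abs_self C))
  have key : w 2 * w i - v 2 * v i = (w 2 - v 2) * w i + v 2 * (w i - v i) := by ring
  rw [key]
  calc |(w 2 - v 2) * w i + v 2 * (w i - v i)|
      ≤ |(w 2 - v 2) * w i| + |v 2 * (w i - v i)| := abs_add_le _ _
    _ = |w 2 - v 2| * |w i| + |v 2| * |w i - v i| := by rw [abs_mul, abs_mul]
    _ ≤ ‖w - v‖ * |C'| + |C| * ‖w - v‖ :=
        add_le_add (mul_le_mul h2 hwi (abs_nonneg _) (norm_nonneg _))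
          (mul_le_mul hv2 hi (abs_nonneg _) (abs_nonneg _))
    _ = (|C'| + |C|) * ‖w - v‖ := by ring

/-- **Passing a two-sided uniform scale bound to the blow-down limit.**  If
`|2∫ g uₘ| ≤ 2⁻ᵐ A + B` for all `m`, `g` is integrable and `uₘ → Φ` uniformly on `{g ≠ 0}`, then
`|2∫ g Φ| ≤ B` (the one-sided lemma `fluxSign_limit_le` applied to `±uₘ`). [folklore] -/
theorem zeroStress_limit_abs (g Φ : EuclideanSpace ℝ (Fin 3) → ℝ)
    (u : ℕ → EuclideanSpace ℝ (Fin 3) → ℝ) (A B : ℝ) (hg : Integrable g)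
    (hgu : ∀ m, Integrable fun Y => g Y * u m Y) (hgΦ : Integrable fun Y => g Y * Φ Y)
    (hconv : ∀ ε : ℝ, 0 < ε → ∃ M : ℕ, ∀ m : ℕ, M ≤ m → ∀ Y, g Y ≠ 0 → |u m Y - Φ Y| ≤ ε)
    (hineq : ∀ m : ℕ, |2 * ∫ Y, g Y * u m Y| ≤ ((2 : ℝ) ^ m)⁻¹ * A + B) :
    |2 * ∫ Y, g Y * Φ Y| ≤ B := by
  refine abs_le.2 ⟨?_, fluxSign_limit_le g Φ u A B hg hgu hgΦ hconv
    fun m => (le_abs_self _).trans (hineq m)⟩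
  have hgu' : ∀ m, Integrable fun Y => g Y * (-u m Y) := fun m =>
    (hgu m).neg.congr (Eventually.of_forall fun Y => by simp only [Pi.neg_apply, mul_neg])
  have hgΦ' : Integrable fun Y => g Y * (-Φ Y) :=
    hgΦ.neg.congr (Eventually.of_forall fun Y => by simp only [Pi.neg_apply, mul_neg])
  have hconv' : ∀ ε : ℝ, 0 < ε → ∃ M : ℕ, ∀ m : ℕ, M ≤ m → ∀ Y, g Y ≠ 0 →
      |(-u m Y) - (-Φ Y)| ≤ ε := by
    intro ε hε
    obtain ⟨M, hM⟩ := hconv ε hε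
    refine ⟨M, fun m hm Y hY => ?_⟩
    rw [show -u m Y - -Φ Y = -(u m Y - Φ Y) by ring, abs_neg]
    exact hM m hm Y hY
  have hineq' : ∀ m : ℕ, 2 * ∫ Y, g Y * (-u m Y) ≤ ((2 : ℝ) ^ m)⁻¹ * A + B := by
    intro m
    have h1 : ∫ Y, g Y * (-u m Y) = -∫ Y, g Y * u m Y := by
      rw [← integral_neg]
      exact integral_congr_ae (Eventually.of_forall fun Y => by simp only [mul_neg])
    rw [h1, mul_neg]
    exact (neg_le_abs _).trans (hineq m)
  have key := fluxSign_limit_le g (fun Y => -Φ Y) (fun m Y => -u m Y) A B hg hgu' hgΦ' hconv' hineq'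
  have h2 : ∫ Y, g Y * (-Φ Y) = -∫ Y, g Y * Φ Y := by
    rw [← integral_neg]
    exact integral_congr_ae (Eventually.of_forall fun Y => by simp only [mul_neg])
  rw [h2] at key
  linarith

/-- Registered tools stub of `stub_zeroStress` (line Sketch of crux `DyadicRealisation`): the
conjunction of the lemmas of this file. [folklore] -/
theorem stub_zeroStressTools :
    (∀ (u : EuclideanSpace ℝ (Fin 3) → EuclideanSpace ℝ (Fin 3)) (p : EuclideanSpace ℝ (Fin 3) → ℝ)
    (φ : EuclideanSpace ℝ (Fin 3) → ℝ) (a : EuclideanSpace ℝ (Fin 3)),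
    Literature.Analysis.FluidPDE.IsLerayProfile 1 0 u p → ContDiff ℝ 2 φ → HasCompactSupport φ → (∫
    x : EuclideanSpace ℝ (Fin 3), inner ℝ (u x) a * fderiv ℝ φ x (u x)) + (∫ x : EuclideanSpace ℝ
    (Fin 3), p x * fderiv ℝ φ x a) + (∫ x : EuclideanSpace ℝ (Fin 3), Laplacian.laplacian φ x *
    inner ℝ (u x) a) = 0) ∧ (∀ (W : EuclideanSpace ℝ (Fin 3) → EuclideanSpace ℝ (Fin 3)) (P :
    EuclideanSpace ℝ (Fin 3) → ℝ) (φ : EuclideanSpace ℝ (Fin 3) → ℝ) (C' : ℝ) (i : Fin 3), ContDiff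
    ℝ ((⊤ : ℕ∞) : WithTop ℕ∞) W → ContDiff ℝ ((⊤ : ℕ∞) : WithTop ℕ∞) P → (∀ X : EuclideanSpace ℝ
    (Fin 3), ∑ i : Fin 3, (fderiv ℝ W X (EuclideanSpace.single i (1 : ℝ))) i = 0) → (∀ X :
    EuclideanSpace ℝ (Fin 3), (fderiv ℝ W X) (W X) + gradient P X = ∑ i : Fin 3, fderiv ℝ (fun Y =>
    fderiv ℝ W Y (EuclideanSpace.single i (1 : ℝ))) X (EuclideanSpace.single i (1 : ℝ))) → (∀ X :
    EuclideanSpace ℝ (Fin 3), ‖W X‖ ≤ C') → ContDiff ℝ 2 φ → HasCompactSupport φ → ∃ A : ℝ, ∀ lam :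
    ℝ, 0 < lam → |(∫ Y : EuclideanSpace ℝ (Fin 3), (W (lam • Y)) i * fderiv ℝ φ Y (W (lam • Y))) + ∫
    Y : EuclideanSpace ℝ (Fin 3), P (lam • Y) * fderiv ℝ φ Y (EuclideanSpace.single i (1 : ℝ))| ≤
    lam⁻¹ * A) ∧ (∀ (w v : EuclideanSpace ℝ (Fin 3)) (C C' : ℝ) (i : Fin 3), ‖w‖ ≤ C' → ‖v‖ ≤ C → |w
    2 * w i - v 2 * v i| ≤ (|C'| + |C|) * ‖w - v‖) ∧ (∀ (g Φ : EuclideanSpace ℝ (Fin 3) → ℝ) (u : ℕ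
    → EuclideanSpace ℝ (Fin 3) → ℝ) (A B : ℝ), MeasureTheory.Integrable g → (∀ m,
    MeasureTheory.Integrable fun Y => g Y * u m Y) → (MeasureTheory.Integrable fun Y => g Y * Φ Y) →
    (∀ ε : ℝ, 0 < ε → ∃ M : ℕ, ∀ m : ℕ, M ≤ m → ∀ Y, g Y ≠ 0 → |u m Y - Φ Y| ≤ ε) → (∀ m : ℕ, |2 * ∫
    Y, g Y * u m Y| ≤ ((2 : ℝ) ^ m)⁻¹ * A + B) → |2 * ∫ Y, g Y * Φ Y| ≤ B) :=
  ⟨fun _ _ _ a h hφ hφc => zeroStress_momentum_identity h hφ hφc a, zeroStress_momentum_scaled,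
    zeroStress_density_lipschitz, zeroStress_limit_abs⟩

end Summit.AnomalousDissipation.AnomalousDissipation.Theorems
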